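import Summits.BirchSwinnertonDyer.BirchSwinnertonDyer.Theorems.ByReductionTypeAtTwoSelmerDualInvolutionTwist
import Literature.Barriers.BirchSwinnertonDyer.PAdicFunctionalEquationIdealFormProofs
import Literature.NumberTheory.EllipticCurves.SelmerInftyTorsionFiniteProofs
import Literature.NumberTheory.EllipticCurves.PAdicLFunctionInvolutionProofs
import Literature.NumberTheory.EllipticCurves.CaiShuTian2014.HeegnerConditionProofs
import HarnessLib

/-!
# CONTRAGREDIENT → COVARIANT bridges for Kato-type divisibilities on the PLAIN dual Selmer data: a divisibility
# `p^m · L ∈ ι(char X)` known for every datum `D′ : W.SelmerDualData κ γ⁻¹` (print's `Λ`-structure) holds for the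
# tree's `γ`-datum `D : W.SelmerDualData κ γ` — by T-TWIST-SEL-1 and the printed functional equation BY NAME

Seat `bsd-2adic-tower-1` GEN 19 (cell `bsd-2adic`; idle-seat wake `plan/WAKE-IDLE-2ADIC-VIIprime-contra-rekey.md`, planner RC-206;
bsd-cited ARM-P RULINGS (658)(d) / (659)(b): «END road → ι-SAFE-by-FE = twin + T-TWIST-SEL-1 + K1 (FE ideal form) + K5
(`Ideal.span_singleton_le_iff_mem`)»). HONEST FRAMING: THEOREMS ONLY — no definition, no named fact, no instance, no `sorry`;
route-independent (no `Theses` import); closes no item; nothing booked; BSD is NOT proved by any of this.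

## Why this file

The PRINT-EXACT twins of Kato's §17.13 ∃-packages (`Kato2004/DivisibilityInputsContragredient.lean`, p604443) bind the dual
Selmer datum in its contragredient `Λ`-structure `D′ : W.SelmerDualData κ γ⁻¹`; the tree's END theorems
(`Kato2004.kato_divisibility_of_inputs`, `Kato2004.katoDivisibility_{nonsplit,split}Mult_of_facts`, the K4 doors) conclude
for `D : W.SelmerDualData κ γ`, `γ` the NORMALISED generator. This file is the package-free half of every such re-key:
GIVEN the conclusion for all contragredient data `D′` (as the module theory run on a twin package delivers it), DERIVE the
same conclusion for `D`. It imports no Kato package (so it elaborates independently of the twins' module) and is the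
analogue, for plain dual Selmer data and the ordinary / multiplicative `p`-adic `L`-functions, of bsd-wall's
`SignedKatoOffTwo.IwasawaInvolution.charIdeal_divisibility_of_contragredient` (signed data, Sprung's `L♭`).

## The mechanism (three facts, all PROVED in the tree)

1. T-TWIST-SEL-1 `exists_twist_selmerDualData_invol_of_mul_inv` (sibling file, p609264): `D` and some `D′` are the same
   group with `Λ` acting through `ι_Λ : T ↦ (1+T)⁻¹ − 1`; torsion ⟺ torsion, `Module.Finite` ⟺ (the twist supplies the
   finiteness of `D′.X` from `SelmerDualData.module_finite_of_isCyclotomic` for the normalised `γ`), and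
   `char(D′) = ι_Λ char(D)`, whence `ι_Λ g ∈ char(D)` for `g ∈ char(D′)` (`invol_mem_of_mem_of_eq_map`).
2. The printed functional equation BY NAME, in ideal form and descended to `Λ` (Greenberg LNM 1716 §1 p. 68:
   "`f(T^ι)/f(T)` should be in `Λ^×`"): good ordinary `IwasawaAlgebra.span_singleton_subst_eq_of_eq_padicLFunction`
   (MTT §I.17 via `padicLFunction_mem_padicFEClass_neg_frickeEigenvalue`, any level); multiplicative `p ∥ N`:
   `Is[Split]MultPAdicLFunctionOf.subst_eq_of_atkinLehner` (sign `exists_sq_eq_one_atkinLehnerInvolution_eq_smul`, exponent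
   `exists_teichmuller_exponent_natCast`) + `IwasawaAlgebra.span_singleton_subst_eq_of_iwasawaToPowerSeries_eq`
   (Burungale–Skinner 2023 Prop. 2.2): for every integral lift `g` of a scalar multiple of `L`, `(ι_Λ g) = (g)` in `Λ`.
3. Hence `g ∈ (g) = (ι_Λ g) ⊆ char(D)` (`mem_of_invol_mem_of_span_subst_eq`); in the exceptional-zero shape `ι(T·g) = p^m L`
   the lift is `T·g` and `T` is cancelled in the domain `Λ` using `ι_Λ(T)·(1+T) = −T`
   (`mem_of_invol_mem_of_span_X_mul_subst_eq`). The SAME witnesses `(m, g)` serve `D`.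

## What is proved

§1 algebra in `Λ`: `invol_mem_of_mem_of_eq_map`, `mem_of_invol_mem_of_span_subst_eq` (with
`SignedKatoOffTwo.Invol.invol_eq_subst_invOnePlusSubOne`: `ι_Λ g = g(T^ι)`),
`mem_of_invol_mem_of_span_X_mul_subst_eq`; level bookkeeping `conductorNorm_eq_mul_div_and_not_dvd` (`N_W = p·(N_W/p)`,
`p ∤ N_W/p` at a multiplicative `p`, from the PROVED `f_p = 1`). §2 bridges (hypothesis `h` = the conclusion for every
finitely generated contragredient datum `D′ : W.SelmerDualData κ γ⁻¹`; conclusion = the same for `D`):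
**`katoBody_of_contra`** (good ordinary: the three clauses of `kato_divisibility` — torsion, `ι g = p^n L_p`, and under
surjectivity `ι g = L_p`), **`multNonsplitBody_of_contra`** (`ι g = p^m L`, `L` THE MTT function `α = −1`, level `N = pM`),
**`multSplitBody_of_contra`** (`ι(T g) = p^m L`, `IsSplitMultPAdicLFunctionOf`), and the conductor-level forms
`multNonsplitBody_of_contra_conductorLevel` / `multSplitBody_of_contra_conductorLevel` (no level hypothesis).

References: [GreenbergLNM1716, §1 (pp. 60, 67–68)]; [Greenberg1989, §0 pp. 101–102 (S^ι)]; [MazurTateTeitelbaum1986Invent, §I.17];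
[BurungaleSkinner2023, Prop. 2.2]; [Kato2004Asterisque, Thm. 17.4 (p. 273), §17.13 (pp. 279–280)]; [Knapp1993, Thm. 9.27(b)];
[Silverman1994, IV.10.2(b)].
-/

set_option autoImplicit false
-- the Theorems namespace of this sub repeats the summit name by design (D-0017 nested layout)
set_option linter.dupNamespace false

noncomputable section

open scoped Classical MatrixGroups ModularForm

namespace Summit.BirchSwinnertonDyer.BirchSwinnertonDyer.Theorems

namespace SelmerDualContra

open PowerSeries CongruenceSubgroup Field Literature.NumberTheory.EllipticCurves
  Literature.NumberTheory.EllipticCurves.Module Literature.NumberTheory.EllipticCurves.ModularForms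
  Literature.Barriers.BirchSwinnertonDyer SignedKatoOffTwo.IwasawaInvolution

/-! ## §1 Pure algebra in `Λ = ℤ_p⟦T⟧`: membership transfer along the involution; level bookkeeping -/

section Algebra

variable {p : ℕ} [Fact p.Prime]

/-- If `J = I.map ι_Λ` (e.g. `char(D′) = ι_Λ char(D)`) and `g ∈ J` then `ι_Λ g ∈ I` (`ι_Λ` is an involution).
[folklore] -/
theorem invol_mem_of_mem_of_eq_map {I J : Ideal (IwasawaAlgebra p)}
    (hJ : J = I.map (IwasawaAlgebra.invol p)) {g : IwasawaAlgebra p} (hg : g ∈ J) :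
    IwasawaAlgebra.invol p g ∈ I := by
  rw [hJ, Ideal.mem_map_iff_of_surjective (IwasawaAlgebra.invol p) (IwasawaAlgebra.invol_bijective p).2] at hg
  obtain ⟨x, hx, rfl⟩ := hg
  rwa [IwasawaAlgebra.invol_invol]

/-- **Plain transfer**: if `ι_Λ g ∈ I` and `(g(T^ι)) = (g)` as ideals of `Λ` (the descended functional equation) then
`g ∈ I`. [cite: GreenbergLNM1716, §1 (p. 68: f(T^ι)/f(T) ∈ Λ^×)] -/
theorem mem_of_invol_mem_of_span_subst_eq {I : Ideal (IwasawaAlgebra p)} {g : IwasawaAlgebra p}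
    (h1 : IwasawaAlgebra.invol p g ∈ I)
    (h2 : Ideal.span {g.subst (invOnePlusSubOne : ℤ_[p]⟦X⟧)} = Ideal.span {g}) : g ∈ I := by
  have hg : g ∈ Ideal.span {g.subst (invOnePlusSubOne : ℤ_[p]⟦X⟧)} := by
    rw [h2]; exact Ideal.mem_span_singleton_self g
  rw [← SignedKatoOffTwo.Invol.invol_eq_subst_invOnePlusSubOne] at hg
  exact ((Ideal.span_singleton_le_iff_mem _).mpr h1) hg

/-- **Exceptional-zero transfer**: if `ι_Λ g ∈ I` and `((T·g)(T^ι)) = (T·g)` as ideals of `Λ` then `g ∈ I` — cancel `T`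
in the domain `Λ`: `T g = r · ι_Λ(T) · ι_Λ g` and `ι_Λ(T)·(1+T) = −T` give `(1+T) g = −r · ι_Λ g`, and `1+T` is a unit
with inverse `ι_Λ(1+T)`. [cite: GreenbergLNM1716, §1 (p. 68: f(T^ι)/f(T) ∈ Λ^×)] -/
theorem mem_of_invol_mem_of_span_X_mul_subst_eq {I : Ideal (IwasawaAlgebra p)} {g : IwasawaAlgebra p}
    (h1 : IwasawaAlgebra.invol p g ∈ I)
    (h2 : Ideal.span {(X * g : IwasawaAlgebra p).subst (invOnePlusSubOne : ℤ_[p]⟦X⟧)} = Ideal.span {X * g}) :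
    g ∈ I := by
  have hXg : (X * g : IwasawaAlgebra p) ∈
      Ideal.span {(X * g : IwasawaAlgebra p).subst (invOnePlusSubOne : ℤ_[p]⟦X⟧)} := by
    rw [h2]; exact Ideal.mem_span_singleton_self _
  rw [← SignedKatoOffTwo.Invol.invol_eq_subst_invOnePlusSubOne, map_mul] at hXg
  obtain ⟨r, hr⟩ := Ideal.mem_span_singleton'.mp hXg
  -- `T · ((1+T) g) = (1+T) · (T g) = r · (ι_Λ T · (1+T)) · ι_Λ g = T · (−(r · ι_Λ g))`
  have hkey : (X : IwasawaAlgebra p) * ((1 + X) * g) = X * (-(r * IwasawaAlgebra.invol p g)) := by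
    calc (X : IwasawaAlgebra p) * ((1 + X) * g) = (1 + X) * (X * g) := by ring
      _ = (1 + X) * (r * (IwasawaAlgebra.invol p X * IwasawaAlgebra.invol p g)) := by rw [hr]
      _ = r * (IwasawaAlgebra.invol p X * (1 + X)) * IwasawaAlgebra.invol p g := by ring
      _ = X * (-(r * IwasawaAlgebra.invol p g)) := by rw [IwasawaAlgebra.invol_X_mul_one_add_X]; ring
  have hcancel : (1 + X : IwasawaAlgebra p) * g = -(r * IwasawaAlgebra.invol p g) :=
    mul_left_cancel₀ (X_ne_zero (R := ℤ_[p])) hkey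
  have hg : g = IwasawaAlgebra.invol p (1 + X) * (-(r * IwasawaAlgebra.invol p g)) := by
    rw [← hcancel, ← mul_assoc, mul_comm (IwasawaAlgebra.invol p (1 + X)),
      IwasawaAlgebra.one_add_X_mul_invol_one_add_X, one_mul]
  rw [hg]
  exact I.mul_mem_left _ (I.neg_mem (I.mul_mem_left r h1))

/-- `N_W = p · (N_W / p)` and `p ∤ N_W / p` at a multiplicative prime `p` (`f_p = 1`, Silverman ATAEC IV.10.2(b); tree:
`WeierstrassCurve.factorization_conductorNorm_eq_one_of_hasMultiplicativeReductionAtPrime`) — discharges the level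
hypotheses `N = pM`, `p ∤ M` of the printed multiplicative functional equation at the conductor level.
[cite: Silverman1994, IV.10.2(b)] -/
theorem conductorNorm_eq_mul_div_and_not_dvd {W : WeierstrassCurve ℚ} [W.IsElliptic] [NeZero (W.conductorNorm ℤ)]
    (hmult : W.HasMultiplicativeReductionAtPrime p) :
    W.conductorNorm ℤ = p * (W.conductorNorm ℤ / p) ∧ ¬ p ∣ W.conductorNorm ℤ / p := by
  have hpP : p.Prime := Fact.out
  have hN0 : W.conductorNorm ℤ ≠ 0 := NeZero.ne _
  have h1 := W.factorization_conductorNorm_eq_one_of_hasMultiplicativeReductionAtPrime p hmult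
  have hpN : p ∣ W.conductorNorm ℤ := Nat.dvd_of_factorization_pos (by omega)
  refine ⟨(Nat.mul_div_cancel' hpN).symm, fun h ↦ ?_⟩
  have h2 : p ^ 2 ∣ W.conductorNorm ℤ := by
    rw [pow_two, ← Nat.mul_div_cancel' hpN]
    exact Nat.mul_dvd_mul_left p h
  have := (hpP.pow_dvd_iff_le_factorization hN0).mp h2
  omega

end Algebra

/-! ## §2 The bridges: a divisibility known for every contragredient datum holds for the tree's datum -/

section Bridge

variable {W : WeierstrassCurve ℚ} [W.IsElliptic] [W.IsGloballyMinimal] {p : ℕ} [Fact p.Prime]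
  {κ : ZpExtension ℚ p} {γ : absoluteGaloisGroup ℚ} {N : ℕ} [NeZero N] {f : CuspForm (Gamma0 N) 2}

/-- **GOOD ORDINARY bridge (the body of `kato_divisibility`, contragredient → covariant).** Let `W/ℚ` be globally minimal,
good ordinary at `p`, `f` its newform (any level), `(κ, γ)` cyclotomic with `γ` the normalised generator, `D` a `γ`-datum.
If for EVERY finitely generated contragredient datum `D′ : W.SelmerDualData κ γ⁻¹` the three clauses of Kato's Thm. 17.4
hold — `X` torsion; `ι g = p^n · L_p(E,T)` for some `n` and `g ∈ char_Λ`; and, under surjectivity of `ρ̄_{E,p^n}` for all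
`n`, `ι g = L_p(E,T)` for some `g ∈ char_Λ` — then they hold for `D`, with the same witnesses. Inputs: T-TWIST-SEL-1 and
the printed functional equation `L_p(E,T^ι) ∈ Λ^×·L_p(E,T)` by name (`IwasawaAlgebra.span_singleton_subst_eq_of_eq_padicLFunction`).
[cite: Kato2004Asterisque, Thm. 17.4 (p. 273) and §17.13 (pp. 279–280)] [cite: MazurTateTeitelbaum1986Invent, §I.17]
[cite: GreenbergLNM1716, §1 (pp. 67–68)] [cite: Greenberg1989, §0 pp. 101–102 (S^ι)] -/
theorem katoBody_of_contra (hord : IsOrdinaryAt W p) (hf : IsNewformOf W f) (hκ : κ.IsCyclotomic)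
    (hγ : κ.IsTopGenerator γ) (D : W.SelmerDualData κ γ)
    (h : ∀ D' : W.SelmerDualData κ γ⁻¹, Module.Finite (IwasawaAlgebra p) D'.X →
      D'.IsTorsion ∧
      (∃ (n : ℕ) (g : IwasawaAlgebra p), g ∈ D'.charIdeal ∧
        iwasawaToPowerSeries p g =
          PowerSeries.C ((p : ℚ_[p]) ^ n) * padicLFunction f (unitRoot W p : ℚ_[p])) ∧
      ((∀ n : ℕ, W.HasSurjectiveModNGaloisRep (p ^ n : ℕ)) →
        ∃ g ∈ D'.charIdeal, iwasawaToPowerSeries p g = padicLFunction f (unitRoot W p : ℚ_[p]))) :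
    D.IsTorsion ∧
    (∃ (n : ℕ) (g : IwasawaAlgebra p), g ∈ D.charIdeal ∧
      iwasawaToPowerSeries p g =
        PowerSeries.C ((p : ℚ_[p]) ^ n) * padicLFunction f (unitRoot W p : ℚ_[p])) ∧
    ((∀ n : ℕ, W.HasSurjectiveModNGaloisRep (p ^ n : ℕ)) →
      ∃ g ∈ D.charIdeal, iwasawaToPowerSeries p g = padicLFunction f (unitRoot W p : ℚ_[p])) := by
  obtain ⟨D', e, -, -, htors, hchar, -, hfin⟩ := exists_twist_selmerDualData_invol_of_mul_inv (p := p) D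
  haveI hfinD : Module.Finite (IwasawaAlgebra p) D.X := D.module_finite_of_isCyclotomic W κ hκ hγ
  obtain ⟨htors', ⟨n, g, hg, hιg⟩, h3⟩ := h D' (hfin.mp hfinD)
  refine ⟨htors.mpr htors', ⟨n, g, ?_, hιg⟩, fun hsurj ↦ ?_⟩
  · exact mem_of_invol_mem_of_span_subst_eq (invol_mem_of_mem_of_eq_map hchar hg)
      (IwasawaAlgebra.span_singleton_subst_eq_of_eq_padicLFunction hord hf hιg)
  · obtain ⟨g', hg', hιg'⟩ := h3 hsurj
    have hb : iwasawaToPowerSeries p g' =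
        PowerSeries.C (1 : ℚ_[p]) * padicLFunction f (unitRoot W p : ℚ_[p]) := by
      rw [map_one, one_mul]; exact hιg'
    exact ⟨g', mem_of_invol_mem_of_span_subst_eq (invol_mem_of_mem_of_eq_map hchar hg')
      (IwasawaAlgebra.span_singleton_subst_eq_of_eq_padicLFunction hord hf hb), hιg'⟩

omit [W.IsGloballyMinimal] in
/-- **MULTIPLICATIVE NON-SPLIT bridge.** Let `W/ℚ` be multiplicative non-split at `p`, `f` its newform of level `N = pM`
(`p ∤ M`), `L` THE Mazur–Tate–Teitelbaum function (`IsMultPAdicLFunctionOf f p (−1) L`), `(κ, γ)` cyclotomic with `γ`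
normalised, `D` a `γ`-datum. If for every finitely generated contragredient datum `D′` the module `X` is torsion and
`ι g = p^m · L` for some `m` and `g ∈ char_Λ`, then the same holds for `D` (same witnesses). Inputs: T-TWIST-SEL-1 and the
printed functional equation (MTT §I.17, `IsMultPAdicLFunctionOf.subst_eq_of_atkinLehner`; sign and exponent produced,
not assumed) descended to `Λ` (`IwasawaAlgebra.span_singleton_subst_eq_of_iwasawaToPowerSeries_eq`).
[cite: Kato2004Asterisque, Thm. 17.4 (1)(2) (p. 273; shape) and §17.13 (pp. 279–280)] [cite: MazurTateTeitelbaum1986Invent, §I.17]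
[cite: Knapp1993, Thm. 9.27(b)] [cite: Greenberg1989, §0 pp. 101–102 (S^ι)] -/
theorem multNonsplitBody_of_contra (hf : IsNewformOf W f) (hmult : W.HasMultiplicativeReductionAtPrime p)
    (hns : ¬ W.HasSplitMultiplicativeReductionAtPrime p) {M : ℕ} (hNM : N = p * M) (hpM : ¬ p ∣ M)
    {L : PowerSeries ℚ_[p]} (hLf : IsMultPAdicLFunctionOf f p (-1) L) (hκ : κ.IsCyclotomic)
    (hγ : κ.IsTopGenerator γ) (D : W.SelmerDualData κ γ)
    (h : ∀ D' : W.SelmerDualData κ γ⁻¹, Module.Finite (IwasawaAlgebra p) D'.X →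
      D'.IsTorsion ∧ ∃ (m : ℕ) (g : IwasawaAlgebra p), g ∈ D'.charIdeal ∧
        iwasawaToPowerSeries p g = PowerSeries.C ((p : ℚ_[p]) ^ m) * L) :
    D.IsTorsion ∧ ∃ (m : ℕ) (g : IwasawaAlgebra p), g ∈ D.charIdeal ∧
      iwasawaToPowerSeries p g = PowerSeries.C ((p : ℚ_[p]) ^ m) * L := by
  obtain ⟨D', e, -, -, htors, hchar, -, hfin⟩ := exists_twist_selmerDualData_invol_of_mul_inv (p := p) D
  haveI hfinD : Module.Finite (IwasawaAlgebra p) D.X := D.module_finite_of_isCyclotomic W κ hκ hγ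
  obtain ⟨htors', m, g, hg, hιg⟩ := h D' (hfin.mp hfinD)
  refine ⟨htors.mpr htors', m, g, ?_, hιg⟩
  have hM0 : M ≠ 0 := by rintro rfl; exact hpM (dvd_zero p)
  haveI : NeZero M := ⟨hM0⟩
  obtain ⟨σ, hσ, hW⟩ := exists_sq_eq_one_atkinLehnerInvolution_eq_smul hf hNM hpM
  obtain ⟨ηM, c, hc⟩ := exists_teichmuller_exponent_natCast p hpM
  have hFE := hLf.subst_eq_of_atkinLehner hf hmult hns hNM hpM hσ hW hc
    one_add_X_mul_invOnePlusSubOne_add_one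
  exact mem_of_invol_mem_of_span_subst_eq (invol_mem_of_mem_of_eq_map hchar hg)
    (IwasawaAlgebra.span_singleton_subst_eq_of_iwasawaToPowerSeries_eq hσ hFE hιg)

omit [W.IsGloballyMinimal] in
/-- **MULTIPLICATIVE SPLIT bridge (exceptional zero divided out).** Let `W/ℚ` be split multiplicative at `p`, `f` its
newform of level `N = pM` (`p ∤ M`), `L` with `IsSplitMultPAdicLFunctionOf f p L`, `(κ, γ)` cyclotomic with `γ`
normalised, `D` a `γ`-datum. If for every finitely generated contragredient datum `D′` the module `X` is torsion and
`ι(T·g) = p^m · L` for some `m` and `g ∈ char_Λ`, then the same holds for `D` (same witnesses; `T` is cancelled in `Λ`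
by `mem_of_invol_mem_of_span_X_mul_subst_eq`). [cite: Kato2004Asterisque, §17.13 (pp. 279–280)]
[cite: Wuthrich2014, Cor. 19 (p. 398; shape)] [cite: MazurTateTeitelbaum1986Invent, §I.17] [cite: Greenberg1989, §0 pp. 101–102 (S^ι)] -/
theorem multSplitBody_of_contra (hf : IsNewformOf W f) (hsp : W.HasSplitMultiplicativeReductionAtPrime p)
    {M : ℕ} (hNM : N = p * M) (hpM : ¬ p ∣ M) {L : PowerSeries ℚ_[p]} (hLf : IsSplitMultPAdicLFunctionOf f p L)
    (hκ : κ.IsCyclotomic) (hγ : κ.IsTopGenerator γ) (D : W.SelmerDualData κ γ)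
    (h : ∀ D' : W.SelmerDualData κ γ⁻¹, Module.Finite (IwasawaAlgebra p) D'.X →
      D'.IsTorsion ∧ ∃ (m : ℕ) (g : IwasawaAlgebra p), g ∈ D'.charIdeal ∧
        iwasawaToPowerSeries p (PowerSeries.X * g) = PowerSeries.C ((p : ℚ_[p]) ^ m) * L) :
    D.IsTorsion ∧ ∃ (m : ℕ) (g : IwasawaAlgebra p), g ∈ D.charIdeal ∧
      iwasawaToPowerSeries p (PowerSeries.X * g) = PowerSeries.C ((p : ℚ_[p]) ^ m) * L := by
  obtain ⟨D', e, -, -, htors, hchar, -, hfin⟩ := exists_twist_selmerDualData_invol_of_mul_inv (p := p) D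
  haveI hfinD : Module.Finite (IwasawaAlgebra p) D.X := D.module_finite_of_isCyclotomic W κ hκ hγ
  obtain ⟨htors', m, g, hg, hιg⟩ := h D' (hfin.mp hfinD)
  refine ⟨htors.mpr htors', m, g, ?_, hιg⟩
  have hM0 : M ≠ 0 := by rintro rfl; exact hpM (dvd_zero p)
  haveI : NeZero M := ⟨hM0⟩
  obtain ⟨σ, hσ, hW⟩ := exists_sq_eq_one_atkinLehnerInvolution_eq_smul hf hNM hpM
  obtain ⟨ηM, c, hc⟩ := exists_teichmuller_exponent_natCast p hpM
  have hFE := hLf.subst_eq_of_atkinLehner hsp hf hNM hpM hσ hW hc one_add_X_mul_invOnePlusSubOne_add_one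
  exact mem_of_invol_mem_of_span_X_mul_subst_eq (invol_mem_of_mem_of_eq_map hchar hg)
    (IwasawaAlgebra.span_singleton_subst_eq_of_iwasawaToPowerSeries_eq hσ hFE hιg)

omit [W.IsGloballyMinimal] in
/-- **Multiplicative non-split bridge at the conductor level** (`f` of level `N_W`; the level hypotheses are discharged by
`conductorNorm_eq_mul_div_and_not_dvd`). [cite: Kato2004Asterisque, §17.13 (pp. 279–280)] [cite: MazurTateTeitelbaum1986Invent, §I.17] -/
theorem multNonsplitBody_of_contra_conductorLevel [NeZero (W.conductorNorm ℤ)]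
    {f : CuspForm (Gamma0 (W.conductorNorm ℤ)) 2} (hf : IsNewformOf W f)
    (hmult : W.HasMultiplicativeReductionAtPrime p) (hns : ¬ W.HasSplitMultiplicativeReductionAtPrime p)
    {L : PowerSeries ℚ_[p]} (hLf : IsMultPAdicLFunctionOf f p (-1) L) (hκ : κ.IsCyclotomic)
    (hγ : κ.IsTopGenerator γ) (D : W.SelmerDualData κ γ)
    (h : ∀ D' : W.SelmerDualData κ γ⁻¹, Module.Finite (IwasawaAlgebra p) D'.X →
      D'.IsTorsion ∧ ∃ (m : ℕ) (g : IwasawaAlgebra p), g ∈ D'.charIdeal ∧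
        iwasawaToPowerSeries p g = PowerSeries.C ((p : ℚ_[p]) ^ m) * L) :
    D.IsTorsion ∧ ∃ (m : ℕ) (g : IwasawaAlgebra p), g ∈ D.charIdeal ∧
      iwasawaToPowerSeries p g = PowerSeries.C ((p : ℚ_[p]) ^ m) * L := by
  obtain ⟨hNM, hpM⟩ := conductorNorm_eq_mul_div_and_not_dvd (W := W) hmult
  exact multNonsplitBody_of_contra hf hmult hns hNM hpM hLf hκ hγ D h

omit [W.IsGloballyMinimal] in
/-- **Multiplicative split bridge at the conductor level** (`f` of level `N_W`). [cite: Kato2004Asterisque, §17.13 (pp. 279–280)]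
[cite: MazurTateTeitelbaum1986Invent, §I.17] -/
theorem multSplitBody_of_contra_conductorLevel [NeZero (W.conductorNorm ℤ)]
    {f : CuspForm (Gamma0 (W.conductorNorm ℤ)) 2} (hf : IsNewformOf W f)
    (hsp : W.HasSplitMultiplicativeReductionAtPrime p) {L : PowerSeries ℚ_[p]}
    (hLf : IsSplitMultPAdicLFunctionOf f p L) (hκ : κ.IsCyclotomic) (hγ : κ.IsTopGenerator γ)
    (D : W.SelmerDualData κ γ)
    (h : ∀ D' : W.SelmerDualData κ γ⁻¹, Module.Finite (IwasawaAlgebra p) D'.X →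
      D'.IsTorsion ∧ ∃ (m : ℕ) (g : IwasawaAlgebra p), g ∈ D'.charIdeal ∧
        iwasawaToPowerSeries p (PowerSeries.X * g) = PowerSeries.C ((p : ℚ_[p]) ^ m) * L) :
    D.IsTorsion ∧ ∃ (m : ℕ) (g : IwasawaAlgebra p), g ∈ D.charIdeal ∧
      iwasawaToPowerSeries p (PowerSeries.X * g) = PowerSeries.C ((p : ℚ_[p]) ^ m) * L := by
  obtain ⟨hNM, hpM⟩ := conductorNorm_eq_mul_div_and_not_dvd (W := W) hsp.hasMultiplicativeReductionAtPrime
  exact multSplitBody_of_contra hf hsp hNM hpM hLf hκ hγ D h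

end Bridge

end SelmerDualContra

end Summit.BirchSwinnertonDyer.BirchSwinnertonDyer.Theorems

end
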